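import Summits.BirchSwinnertonDyer.Rank1Residual.F1Sign2.PencilTransportAtTwo
import HarnessLib

/-!
# Cell `bsd-f1-sign2` (`p = 2`, non-CM) — 2-descent / real-place lens (seat `-desc`) g1: PROOFS for
# `F1Sign2/PencilTransportAtTwo.lean` — `pencilLemma : PencilLemma` (DESC-S2 is a theorem),
# `threeLineLayerLaw_of_pencilTransport : PencilTransportAtTwo → ThreeLineLayerLawAtTwo` (DESC-E = DESC-C +
# algebra), `hasRationalTwoTorsionX_of_isRealTwoDivRoot`

PROOF FILE (typer seat `bsd-f1-sign2-ty`): theorems only — no definition, no named fact, no `@[conjecture]`;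
closes the obligation node `PencilLemma` of the sibling statement file BY NAME and proves the two glue
theorems. Source: `HOME/MEMO-desc-data/Sketch-v1.3.lean` sha16 82f53a80310d89d4 §«v1.3 proved bookkeeping»
(planner bsd-f1-sign2-desc g1; `lean check` rc 0, 0 warnings, 0 sorries), re-filed VERBATIM (docstrings added
to the two private-style helpers `add_add_cancel_left_F2`, `shadowLayer_add_of`; REF1-AUDIT-v1 §9.3: `PencilLemma`
PROVED-by-author, glue «clear to file»; the moot `oddLevelTransportImpliesSS_of` is NOT filed). PARTITION: none
moved. Beyond-print: no (ultrametric folklore over `𝔽₂[T]` + a real cubic has ≤ 3 roots).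

References: HOME MEMO-desc.md §9.8, MEMO-desc-data/Sketch-v1.3.lean 82f53a80310d89d4, REF1-AUDIT-v1.md §9.3.
-/

set_option autoImplicit false

noncomputable section

open scoped Classical MatrixGroups ModularForm
open CongruenceSubgroup WeierstrassCurve PowerSeries
open Literature.NumberTheory.EllipticCurves Literature.NumberTheory.EllipticCurves.ModularForms

namespace Summit.BirchSwinnertonDyer.Rank1Residual.F1Sign2

/-! ## v1.3 proved bookkeeping (g1): the pencil lemma holds, so DESC-E is DESC-C + algebra -/

/-- Ultrametric inequality for `natTrailingDegree` (any semiring). -/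
private theorem min_natTrailingDegree_le_add {R : Type*} [Semiring R] {A B : Polynomial R}
    (hAB : A + B ≠ 0) :
    min A.natTrailingDegree B.natTrailingDegree ≤ (A + B).natTrailingDegree := by
  apply Polynomial.le_natTrailingDegree hAB
  intro m hm
  rw [Polynomial.coeff_add,
    Polynomial.coeff_eq_zero_of_lt_natTrailingDegree (lt_of_lt_of_le hm (min_le_left _ _)),
    Polynomial.coeff_eq_zero_of_lt_natTrailingDegree (lt_of_lt_of_le hm (min_le_right _ _)), add_zero]

/-- Helper `add_add_cancel_left_F2` for the proofs of `pencilLemma` / `threeLineLayerLaw_of_pencilTransport` (bookkeeping). [folklore] -/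
private theorem add_add_cancel_left_F2 (A B : Polynomial (ZMod 2)) : A + (A + B) = B := by
  have h : A + A = 0 := by
    ext n
    simp only [Polynomial.coeff_add, Polynomial.coeff_zero]
    exact CharTwo.add_self_eq_zero _
  rw [← add_assoc, h, zero_add]

/-- **The pencil lemma is a theorem** (`PencilLemma` holds): over `𝔽₂[X]` the trailing degrees of
`A`, `B`, `A + B` are two-equal-third-larger, or all `⊤`. -/
theorem pencilLemma : PencilLemma := by
  intro A B
  unfold IsIsoscelesTop
  by_cases hA : A = 0
  · subst hA
    by_cases hB : B = 0
    · subst hB; right; right; right; simp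
    · right; right; left
      refine ⟨by simp, ?_⟩
      rw [Polynomial.trailingDegree_zero, Polynomial.trailingDegree_eq_natTrailingDegree hB]
      exact WithTop.coe_lt_top _
  by_cases hB : B = 0
  · subst hB
    right; left
    refine ⟨by simp, ?_⟩
    rw [Polynomial.trailingDegree_zero, Polynomial.trailingDegree_eq_natTrailingDegree hA]
    exact WithTop.coe_lt_top _
  by_cases hAB : A + B = 0
  · have hBA : B = A := by
      have := add_add_cancel_left_F2 A B
      rw [hAB, add_zero] at this
      exact this.symm
    subst hBA
    left
    refine ⟨rfl, ?_⟩
    rw [hAB, Polynomial.trailingDegree_zero, Polynomial.trailingDegree_eq_natTrailingDegree hA]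
    exact WithTop.coe_lt_top _
  -- all three nonzero: work in ℕ
  have h1 := min_natTrailingDegree_le_add hAB
  have hB' : A + (A + B) ≠ 0 := by rw [add_add_cancel_left_F2]; exact hB
  have h2 := min_natTrailingDegree_le_add hB'
  rw [add_add_cancel_left_F2] at h2
  have hA' : B + (A + B) ≠ 0 := by rw [add_comm A B, add_add_cancel_left_F2]; exact hA
  have h3 := min_natTrailingDegree_le_add hA'
  rw [add_comm A B, add_add_cancel_left_F2, add_comm B A] at h3
  -- not all equal: coefficients in 𝔽₂
  have hne : ¬ (A.natTrailingDegree = B.natTrailingDegree ∧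
      A.natTrailingDegree = (A + B).natTrailingDegree) := by
    rintro ⟨hab, hac⟩
    have cA := Polynomial.coeff_natTrailingDegree_ne_zero.mpr hA
    have cB := Polynomial.coeff_natTrailingDegree_ne_zero.mpr hB
    have cC := Polynomial.coeff_natTrailingDegree_ne_zero.mpr hAB
    rw [← hab] at cB
    rw [← hac, Polynomial.coeff_add] at cC
    have key : ∀ x y : ZMod 2, x ≠ 0 → y ≠ 0 → x + y = 0 := by decide
    exact cC (key _ _ cA cB)
  rw [Polynomial.trailingDegree_eq_natTrailingDegree hA, Polynomial.trailingDegree_eq_natTrailingDegree hB,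
    Polynomial.trailingDegree_eq_natTrailingDegree hAB]
  simp only [Nat.cast_inj, Nat.cast_lt, ENat.coe_ne_top, and_false, or_false]
  omega

/-- A real cubic `4θ³ + b₂θ² + 2b₄θ + b₆` has no four distinct real roots. -/
private theorem no_four_realTwoDivRoots (W : WeierstrassCurve ℚ) {a b c d : ℝ}
    (ha : IsRealTwoDivRoot W a) (hb : IsRealTwoDivRoot W b) (hc : IsRealTwoDivRoot W c)
    (hd : IsRealTwoDivRoot W d) (hab : a < b) (hbc : b < c) (hcd : c < d) : False := by
  set p : Polynomial ℝ := Polynomial.C (4 : ℝ) * Polynomial.X ^ 3 + Polynomial.C (W.b₂ : ℝ) *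
    Polynomial.X ^ 2 + Polynomial.C (2 * (W.b₄ : ℝ)) * Polynomial.X + Polynomial.C (W.b₆ : ℝ) with hp_def
  have hp : p ≠ 0 := by
    intro h0
    have hl : p.leadingCoeff = 4 := Polynomial.leadingCoeff_cubic (by norm_num)
    rw [h0, Polynomial.leadingCoeff_zero] at hl
    norm_num at hl
  have hroot : ∀ x : ℝ, IsRealTwoDivRoot W x → x ∈ p.roots.toFinset := by
    intro x hx
    rw [Multiset.mem_toFinset, Polynomial.mem_roots hp, Polynomial.IsRoot.def]
    simp only [hp_def, Polynomial.eval_add, Polynomial.eval_mul, Polynomial.eval_C, Polynomial.eval_pow,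
      Polynomial.eval_X]
    unfold IsRealTwoDivRoot at hx
    linarith
  have hsub : ({a, b, c, d} : Finset ℝ) ⊆ p.roots.toFinset := by
    intro x hx
    simp only [Finset.mem_insert, Finset.mem_singleton] at hx
    rcases hx with rfl | rfl | rfl | rfl
    · exact hroot _ ha
    · exact hroot _ hb
    · exact hroot _ hc
    · exact hroot _ hd
  have h3 : c ∉ ({d} : Finset ℝ) := by simp [hcd.ne]
  have h2 : b ∉ ({c, d} : Finset ℝ) := by simp [hbc.ne, (hbc.trans hcd).ne]
  have h1 : a ∉ ({b, c, d} : Finset ℝ) := by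
    simp [hab.ne, (hab.trans hbc).ne, ((hab.trans hbc).trans hcd).ne]
  have hcard : ({a, b, c, d} : Finset ℝ).card = 4 := by
    rw [Finset.card_insert_of_notMem h1, Finset.card_insert_of_notMem h2,
      Finset.card_insert_of_notMem h3, Finset.card_singleton]
  have h4 := Finset.card_le_card hsub
  have h5 : p.roots.toFinset.card ≤ Multiset.card p.roots := Multiset.toFinset_card_le _
  have h6 : Multiset.card p.roots ≤ p.natDegree := Polynomial.card_roots' p
  have h7 : p.natDegree ≤ 3 := Polynomial.natDegree_cubic_le
  omega

/-- `shadowLayer` is additive in the shadow. -/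
private theorem shadowLayer_congr {c c' : ℚ → ZMod 2} {n : ℕ}
    (h : ∀ k : ℕ, c ((5 : ℚ) ^ k / 2 ^ (n + 2)) = c' ((5 : ℚ) ^ k / 2 ^ (n + 2))) :
    shadowLayer c n = shadowLayer c' n := by
  unfold shadowLayer
  exact Finset.sum_congr rfl (fun k _ => by rw [h k])

/-- Helper `shadowLayer_add_of` for the proofs of `pencilLemma` / `threeLineLayerLaw_of_pencilTransport` (bookkeeping). [folklore] -/
private theorem shadowLayer_add_of {c c₁ c₂ : ℚ → ZMod 2} {n : ℕ}
    (h : ∀ k : ℕ, c ((5 : ℚ) ^ k / 2 ^ (n + 2)) =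
      c₁ ((5 : ℚ) ^ k / 2 ^ (n + 2)) + c₂ ((5 : ℚ) ^ k / 2 ^ (n + 2))) :
    shadowLayer c n = shadowLayer c₁ n + shadowLayer c₂ n := by
  unfold shadowLayer
  rw [← Finset.sum_add_distrib]
  exact Finset.sum_congr rfl (fun k _ => by rw [h k, Polynomial.C_add, add_mul])

/-- **DESC-E is DESC-C plus algebra (proved glue, g1):** the pencil transport implies the three-line
layer law. Inputs beyond `PencilTransportAtTwo`: a real cubic has at most three roots (so of the two
non-least block roots exactly one is the largest), additivity of `shadowLayer`, and `pencilLemma`. -/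
theorem threeLineLayerLaw_of_pencilTransport (hC : PencilTransportAtTwo) : ThreeLineLayerLawAtTwo := by
  intro W₁ W₂ W₃ _ _ _ _ _ _ hss₁ hss₂ hss₃ hΔ₁ hΔ₂ hΔ₃ hsq q₀ q₁ q₂ r₀ r₁ r₂ hq hr θ₁ θ₂ θ₃ hθ₁ hθ₂ hθ₃
    h12 h13 h23 _ _ _ f₁ f₂ f₃ hf₁ hf₂ hf₃ S hS hSN hnz₁ hnz₂ hnz₃ n
  have hN : W₁.conductorNorm ℤ * W₂.conductorNorm ℤ * W₃.conductorNorm ℤ ≠ 0 :=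
    mul_ne_zero (mul_ne_zero (NeZero.ne _) (NeZero.ne _)) (NeZero.ne _)
  have hS₁₂ : (W₁.conductorNorm ℤ * W₂.conductorNorm ℤ).primeFactors ⊆ S :=
    subset_trans (Nat.primeFactors_mono (Dvd.intro _ rfl) hN) hSN
  have hS₁₃ : (W₁.conductorNorm ℤ * W₃.conductorNorm ℤ).primeFactors ⊆ S :=
    subset_trans (Nat.primeFactors_mono ⟨W₂.conductorNorm ℤ, by ring⟩ hN) hSN
  have hT₂ := hC W₁ W₂ hss₁ hss₂ hΔ₁ hΔ₂ hsq q₀ q₁ q₂ hq f₁ f₂ hf₁ hf₂ S hS hS₁₂ hnz₁ hnz₂ θ₂ hθ₂.1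
  have hT₃ := hC W₁ W₃ hss₁ hss₃ hΔ₁ hΔ₃ hsq r₀ r₁ r₂ hr f₁ f₃ hf₁ hf₃ S hS hS₁₃ hnz₁ hnz₃ θ₃ hθ₃.1
  -- the two block roots are not the least root of `ψ₁`
  have hnl₂ : ¬ IsLeastRealTwoDivRoot W₁ θ₂ :=
    fun h => h12 (le_antisymm (hθ₁.2 _ h.1) (h.2 _ hθ₁.1))
  have hnl₃ : ¬ IsLeastRealTwoDivRoot W₁ θ₃ :=
    fun h => h13 (le_antisymm (hθ₁.2 _ h.1) (h.2 _ hθ₁.1))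
  -- exactly one of them is the largest root
  have key : (IsLargestRealTwoDivRoot W₁ θ₂ ∧ ¬ IsLargestRealTwoDivRoot W₁ θ₃) ∨
      (¬ IsLargestRealTwoDivRoot W₁ θ₂ ∧ IsLargestRealTwoDivRoot W₁ θ₃) := by
    by_cases h₂ : IsLargestRealTwoDivRoot W₁ θ₂
    · exact Or.inl ⟨h₂, fun h₃ => h23 (le_antisymm (h₃.2 _ h₂.1) (h₂.2 _ h₃.1))⟩
    · by_cases h₃ : IsLargestRealTwoDivRoot W₁ θ₃
      · exact Or.inr ⟨h₂, h₃⟩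
      · exfalso
        unfold IsLargestRealTwoDivRoot at h₂ h₃
        push Not at h₂ h₃
        obtain ⟨s, hs, hs'⟩ := h₂ hθ₂.1
        obtain ⟨t, ht, ht'⟩ := h₃ hθ₃.1
        have l₂ : θ₁ < θ₂ := lt_of_le_of_ne (hθ₁.2 _ hθ₂.1) h12
        have l₃ : θ₁ < θ₃ := lt_of_le_of_ne (hθ₁.2 _ hθ₃.1) h13
        rcases lt_or_gt_of_ne h23 with hlt | hlt
        · exact no_four_realTwoDivRoots W₁ hθ₁.1 hθ₂.1 hθ₃.1 ht l₂ hlt ht'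
        · exact no_four_realTwoDivRoots W₁ hθ₁.1 hθ₃.1 hθ₂.1 hs l₃ hlt hs'
  -- read the transported shadows at the layer points `5^k / 2^(n+2)`
  have cast5 : ∀ k : ℕ, (((5 : ℤ) ^ k : ℤ) : ℚ) / 2 ^ (n + 2) = (5 : ℚ) ^ k / 2 ^ (n + 2) := by
    intro k; push_cast; rfl
  unfold layerOrder
  rcases key with ⟨hL₂, hL₃⟩ | ⟨hL₂, hL₃⟩
  · -- θ₂ largest (minus line), θ₃ middle (sum line)
    have e₂ : ∀ k : ℕ, plusShadow W₂ f₂ S ((5 : ℚ) ^ k / 2 ^ (n + 2)) =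
        minusShadow W₁ f₁ S ((5 : ℚ) ^ k / 2 ^ (n + 2)) := by
      intro k
      have := hT₂ (n + 2) ((5 : ℤ) ^ k)
      simp only [lineShadow, if_neg hnl₂, if_pos hL₂, if_pos hθ₂.2, cast5] at this
      exact this.symm
    have e₃ : ∀ k : ℕ, plusShadow W₃ f₃ S ((5 : ℚ) ^ k / 2 ^ (n + 2)) =
        plusShadow W₁ f₁ S ((5 : ℚ) ^ k / 2 ^ (n + 2)) +
          minusShadow W₁ f₁ S ((5 : ℚ) ^ k / 2 ^ (n + 2)) := by
      intro k
      have := hT₃ (n + 2) ((5 : ℤ) ^ k)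
      simp only [lineShadow, if_neg hnl₃, if_neg hL₃, if_pos hθ₃.2, cast5] at this
      exact this.symm
    rw [shadowLayer_congr e₂, shadowLayer_add_of e₃]
    exact pencilLemma _ _
  · -- θ₂ middle (sum line), θ₃ largest (minus line)
    have e₂ : ∀ k : ℕ, plusShadow W₂ f₂ S ((5 : ℚ) ^ k / 2 ^ (n + 2)) =
        plusShadow W₁ f₁ S ((5 : ℚ) ^ k / 2 ^ (n + 2)) +
          minusShadow W₁ f₁ S ((5 : ℚ) ^ k / 2 ^ (n + 2)) := by
      intro k
      have := hT₂ (n + 2) ((5 : ℤ) ^ k)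
      simp only [lineShadow, if_neg hnl₂, if_neg hL₂, if_pos hθ₂.2, cast5] at this
      exact this.symm
    have e₃ : ∀ k : ℕ, plusShadow W₃ f₃ S ((5 : ℚ) ^ k / 2 ^ (n + 2)) =
        minusShadow W₁ f₁ S ((5 : ℚ) ^ k / 2 ^ (n + 2)) := by
      intro k
      have := hT₃ (n + 2) ((5 : ℤ) ^ k)
      simp only [lineShadow, if_neg hnl₃, if_pos hL₃, if_pos hθ₃.2, cast5] at this
      exact this.symm
    rw [shadowLayer_add_of e₂, shadowLayer_congr e₃]
    have := pencilLemma (shadowLayer (plusShadow W₁ f₁ S) n)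
      (shadowLayer (plusShadow W₁ f₁ S) n + shadowLayer (minusShadow W₁ f₁ S) n)
    rwa [add_add_cancel_left_F2] at this

/-- A rational root of the `2`-division cubic is the abscissa of a rational point of order `2`
(Greenberg's `HasRationalTwoTorsionX`, tree): `y = −(a₁t + a₃)/2`. -/
theorem hasRationalTwoTorsionX_of_isRealTwoDivRoot (W : WeierstrassCurve ℚ) (t : ℚ)
    (h : IsRealTwoDivRoot W (t : ℝ)) : Greenberg1999.HasRationalTwoTorsionX W t := by
  have hq : 4 * t ^ 3 + W.b₂ * t ^ 2 + 2 * W.b₄ * t + W.b₆ = 0 := by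
    unfold IsRealTwoDivRoot at h
    exact_mod_cast h
  simp only [WeierstrassCurve.b₂, WeierstrassCurve.b₄, WeierstrassCurve.b₆] at hq
  refine ⟨-(W.a₁ * t + W.a₃) / 2, ?_, by ring⟩
  rw [WeierstrassCurve.Affine.equation_iff]
  linear_combination (-(1 : ℚ) / 4) * hq

end Summit.BirchSwinnertonDyer.Rank1Residual.F1Sign2
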